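import Summits.BirchSwinnertonDyer.BirchSwinnertonDyer.Theorems.PrintCf2SplitBadEisensteinTwoDescent
import HarnessLib

/-!
# Crux `PrintCf2.SplitBadTwoRankOneOfFacts` (item 20368), line `eisenstein_two_bdp_line` (skeleton of record **859a52ca**, 7 stubs) — the
# registered `stub_grossLink_two` is a THEOREM MODULO ONE PRINT (Milne 1972): its statement VERBATIM from
# `Milne1972.bsdQuotient_baseChange_quadratic` via cell bsd-p2's over-`K` road

Cell `bsd-print-cf2`, seat `bsd-line-cf2-p1-w2` (prover, width seat on crux stmt-BirchSwinnertonDyer-20368; lead `bsd-line-cf2-p1` g5).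
`--supports stmt-BirchSwinnertonDyer-20368` (helper). Theses-free; THEOREMS ONLY (0 definitions, 0 named facts, 0 `sorry`); CONDITIONAL on the
displayed hypotheses; BSD is proved for no curve by any of this; no summit statement is proved by this seat.

WHAT THIS IS. The LEAD's v5 skeleton of record (859a52caf8e1b3b4, 2026-08-28T09:32Z) registers `stub_control_two` (the exact (∅,0) control at `T = 0`
with net correction `+1` — the D2a shape forced by `PrintCf2SplitBadEisensteinTwoDescentCore`) and `stub_grossLink_two` (the `K → ℚ` descent of `BSD₂`:
both Schneider-free index halves `SchneiderFree.IndexLowerBoundLeAt W 2 K P (v₂ c)` and `SchneiderFree.Upper.IndexUpperBoundLeAt W 2 K P (v₂ c)`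
over a Heegner field with `d_K` odd `< −4` and `L(W^{(d_K)},1) ≠ 0`, plus `BSD₂` of every globally minimal model of the twist ⟹ `BSD₂(W)`); the LEAD's
FINAL called the latter «NOT closable from tree material at 2 … needs Kramer 1981 / Milne 1972 with exact 2-powers». THIS FILE:
**`grossLink_two_of_milne (hMilne : Milne1972.bsdQuotient_baseChange_quadratic) : <statement of stub_grossLink_two VERBATIM>`** — the two halves at the
same slack are the EXACT index identity `2·ord₂ I = ord₂ #Ш(E_K) + 2·ord₂ ∏_ℓ c_ℓ(W) + 2·ord₂ c` (`SchneiderFree.Upper.index_eq_of_lower_of_upper`),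
which is LITERALLY cell bsd-p2's `K`-side `2`-part `ord₂(4·I²/(c²·w_K²·c_K)) = ord₂ #Ш(E_K)` (`w_K = 2` as `d_K < −4`;
`c_K = c_ℚ²` over a Heegner field, `X11b.padicValNat_tamagawaProduct_baseChange_of_heegner_prime`), and `P2.bsdp_iff_bsdp_twist_of_heegnerIndexOverK`
(Gross–Zagier, Kolyvagin, GZK, modularity — all in `ToricPublishedInputs` — and Milne's Weil-restriction identity) transports `BSD₂` from the twist's
minimal model to `W`. So the registered stub's «Gross (2.2) currency» IS the tree's over-`K` currency, with no extra `2`-power: the joint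
calibration the LEAD asked bsd-cm to decide numerically is decided in the kernel GRANTED Milne 1972 (tree named fact, refereed, statement-only) —
the control defect stays `+1`. Reshape option for the LEAD: `stub_grossLink_two` ↦ closed in-file by `grossLink_two_of_milne stub_milne_two` with a
cite-level `stub_milne_two : Milne1972.bsdQuotient_baseChange_quadratic` (pen v5's shape), stubs 7 ↦ 7 with one research stub fewer.

References: [Milne1972ArithmeticAV] §1 Thm. 1; [Gross1991] Conj. (2.2); [GrossZagier1986] I.(6.3), V.(2.2); [Kolyvagin1990] Thm. A; [Miller2011LMS] Def. 1.1.
-/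

set_option autoImplicit false

-- D-0017 layout: summit = sub-problem, so `Summit.BirchSwinnertonDyer.BirchSwinnertonDyer.…` is the mandated namespace of Theorems files.
set_option linter.dupNamespace false

noncomputable section

open scoped Classical MatrixGroups ModularForm Topology NumberField

namespace Summit.BirchSwinnertonDyer.BirchSwinnertonDyer.Theorems.PrintCf2.EisensteinTwo

open Filter CongruenceSubgroup WeierstrassCurve NumberField IsDedekindDomain Field PowerSeries
  Literature.NumberTheory.EllipticCurves Literature.NumberTheory.EllipticCurves.ModularForms
  Literature.NumberTheory.EllipticCurves.LiuZhangZhang2018 Literature.NumberTheory.EllipticCurves.Rank1Residual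
  Literature.NumberTheory.EllipticCurves.Rank1Residual.Typed Literature.NumberTheory.EllipticCurves.KrizLi2019
  Literature.NumberTheory.GaloisRepresentations Literature.NumberTheory.GaloisCohomology
  Summit.BirchSwinnertonDyer.Rank1Residual Summit.BirchSwinnertonDyer.Rank1Residual.X11b
  Summit.BirchSwinnertonDyer.Rank1Residual.X11b.AcSelmer Summit.BirchSwinnertonDyer.Rank1Residual.X11b.CongruenceLimit
  Summit.BirchSwinnertonDyer.Rank1Residual.X11b.Halves Summit.BirchSwinnertonDyer.Rank1Residual.X2
  Summit.BirchSwinnertonDyer.Rank1Residual.Additive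
  Summit.BirchSwinnertonDyer.BirchSwinnertonDyer.Theses.UniversalToricDescent
  Summit.BirchSwinnertonDyer.BirchSwinnertonDyer.Theorems
  Summit.BirchSwinnertonDyer.BirchSwinnertonDyer.Theorems.UniversalToricDescentWaldspurgerFlat

/-- **The registered `stub_grossLink_two` (skeleton 859a52ca) from Milne 1972** — statement VERBATIM after the binder `hMilne`. The two index halves
at slack `v₂ c` give `2·ord₂ [E(K):ℤP] = ord₂ #Ш(E_K) + 2·ord₂ ∏_ℓ c_ℓ(W) + 2·ord₂ c`, i.e. (with `w_K = 2`, `ord₂ c_K = 2·ord₂ c_ℚ`) cell bsd-p2's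
`K`-side identity `ord₂(4·I²/(c²·w_K²·c_K)) = ord₂ #Ш(E_K)`; then `P2.bsdp_iff_bsdp_twist_of_heegnerIndexOverK` and the twist hypothesis at a globally
minimal model of `W^{(d_K)}`. The prints used from `h0` are Gross–Zagier, Kolyvagin, GZK and modularity (conjuncts of `ToricPublishedInputs`); `HasCM`,
`CMSplit`, `¬ Good`, `Odd d_K` are not used. CONDITIONAL; closes nothing by itself (the extra binder `hMilne` is a print, not in the stub).
[cite: Milne1972ArithmeticAV, §1 Thm. 1] [cite: Gross1991, Conj. (2.2)] [cite: GrossZagier1986, I.(6.3) and V.(2.2)] [cite: Kolyvagin1990, Thm. A]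
[cite: Miller2011LMS, Def. 1.1] -/
theorem grossLink_two_of_milne (hMilne : Milne1972.bsdQuotient_baseChange_quadratic) :
    (ToricPublishedInputs ∧
      LiuZhangZhang2018.thm151_thm153_modularCurve_heegnerVector_additive ∧
      bsdTriple_of_hasCM_of_L_one_ne_zero ∧
      (∀ (K : Type) [Field K] [NumberField K], poitouTate_selmerStructure_duality K) ∧
      (∀ (K : Type) [Field K] [NumberField K], poitouTate_sha_tateDual K) ∧
      (∀ (K : Type) [Field K] [NumberField K] (v : HeightOneSpectrum (𝓞 K)),
        localEulerPoincareCharacteristic (v.adicCompletion K)) ∧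
      fieldCdLE_two_of_numberField ∧
      (∀ (K : Type) [Field K] [NumberField K] (p : ℕ) [Fact p.Prime],
        ZpExtension.decomp_not_le_kerSubgroup_of_isAnticyclotomic K p)) →
    ∀ (W : WeierstrassCurve ℚ) [W.IsElliptic] [W.IsGloballyMinimal],
      W.HasCM → W.analyticRank = 1 → CMSplit W 2 → ¬ Good W 2 →
      ∀ (N : ℕ) [NeZero N] (K : Type) [Field K] [NumberField K] (Dt : ModularParametrizationData W N)
        (H : HeegnerDatum N (NumberField.discr K)) (ιK : K →+* ℂ) (P : (W.baseChange K).toAffine.Point),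
        W.conductorNorm ℤ = N → IsImaginaryQuadratic K → SatisfiesHeegnerHypothesis N K → Odd (NumberField.discr K) →
        NumberField.discr K < -4 → (W.quadraticTwist (NumberField.discr K : ℚ)).entireLFunction 1 ≠ 0 →
        WeierstrassCurve.Affine.Point.map ιK.toRatAlgHom P = heegnerPointComplex Dt H → ¬ IsOfFinAddOrder P →
        SchneiderFree.IndexLowerBoundLeAt W 2 K P (padicValNat 2 Dt.c.natAbs) →
        SchneiderFree.Upper.IndexUpperBoundLeAt W 2 K P (padicValNat 2 Dt.c.natAbs) →
        (∀ (Wd : WeierstrassCurve ℚ) [Wd.IsElliptic] [Wd.IsGloballyMinimal],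
          (∃ C : VariableChange ℚ, C • W.quadraticTwist (NumberField.discr K : ℚ) = Wd) → BSDp Wd 2) →
        BSDp W 2 := by
  intro h0 W _ _ _hCM hr _hsplit _hng N _ K _ _ Dt H ιK P hN hK hHN _hodd hd4 hLt hP hnt hlo hup hTw
  obtain ⟨hF, -, -, -, -, -, -, -⟩ := h0
  obtain ⟨hGZ, hKo, hGZK, hmod, -, -, -, -, -, -⟩ := hF
  have h2 : Module.finrank ℚ K = 2 := hK.1
  ------------------------------------------------------------------ Kolyvagin: rank one and finite Ш over `K`
  have hKoK : Literature.NumberTheory.EllipticCurves.kolyvagin N W K := hKo N W K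
  obtain ⟨hrk, hfinK⟩ := hKoK hK hHN ⟨Dt, H, ιK, hP⟩ hnt
  haveI : Finite (W.baseChange K).sha := hfinK
  have hc0 : Dt.c ≠ 0 := Dt.maninConstant_ne_zero_holds
  ------------------------------------------------------------------ the two halves are the exact index identity
  have hidx := SchneiderFree.Upper.index_eq_of_lower_of_upper hlo hup
  ------------------------------------------------------------------ … which is cell bsd-p2's `K`-side identity (`w_K = 2`, `c_K = c_ℚ²`)
  have hw2 : Units.torsionOrder K = 2 :=
    Literature.NumberTheory.QuadraticFields.Quadratic.torsionOrder_eq_two_of_discr_lt_neg_four h2 hd4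
  have htam : padicValNat 2 (W.baseChange K).tamagawaProduct = 2 * padicValNat 2 W.tamagawaProduct :=
    X11b.padicValNat_tamagawaProduct_baseChange_of_heegner_prime (p := 2) W K hK hN hHN
  set I : ℕ := (AddSubgroup.zmultiples P).index with hI_def
  have hheight := Summit.BirchSwinnertonDyer.Rank1Residual.P2.torsionOrder_sq_mul_canonicalHeight_eq_index_sq_mul_regulator
    (W.baseChange K) hrk P hnt
  have htK : 0 < (W.baseChange K).torsionOrder := (W.baseChange K).torsionOrder_pos_holds
  have hI0 : I ≠ 0 := by
    intro hI
    rw [← hI_def, hI] at hheight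
    have h0' : ((W.baseChange K).torsionOrder : ℝ) ^ 2 * P.canonicalHeight = 0 := by rw [hheight]; simp
    rcases mul_eq_zero.mp h0' with h' | h'
    · exact absurd ((pow_eq_zero_iff two_ne_zero).mp h') (by exact_mod_cast htK.ne')
    · exact hnt ((Affine.Point.canonicalHeight_eq_zero_iff_holds P).mp h')
  have hcK : 0 < (W.baseChange K).tamagawaProduct := (W.baseChange K).tamagawaProduct_pos_holds
  have hIQ : (I : ℚ) ≠ 0 := by exact_mod_cast hI0
  have hcQ : (Dt.c : ℚ) ≠ 0 := by exact_mod_cast hc0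
  have hwQ : (Units.torsionOrder K : ℚ) ≠ 0 := by rw [hw2]; norm_num
  have hcKQ : ((W.baseChange K).tamagawaProduct : ℚ) ≠ 0 := by exact_mod_cast hcK.ne'
  have hcval : padicValRat 2 (Dt.c : ℚ) = (padicValNat 2 Dt.c.natAbs : ℤ) := by
    rw [padicValRat.of_int]; rfl
  have h2val : padicValRat 2 (((2 : ℕ) : ℚ)) = 1 := by
    rw [padicValRat.of_nat, padicValNat_self]; rfl
  have h4val : padicValRat 2 (4 : ℚ) = 2 := by
    rw [show (4 : ℚ) = ((2 : ℕ) : ℚ) ^ 2 by norm_num, padicValRat.pow, h2val]; norm_num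
  have hLHS : padicValRat 2 (4 * (I : ℚ) ^ 2 / ((Dt.c : ℚ) ^ 2 * (Units.torsionOrder K : ℚ) ^ 2 *
      ((W.baseChange K).tamagawaProduct : ℚ))) =
      2 + 2 * (padicValNat 2 I : ℤ) - (2 * (padicValNat 2 Dt.c.natAbs : ℤ) + 2 * 1 +
        (padicValNat 2 (W.baseChange K).tamagawaProduct : ℤ)) := by
    rw [padicValRat.div (mul_ne_zero (by norm_num) (pow_ne_zero 2 hIQ))
        (mul_ne_zero (mul_ne_zero (pow_ne_zero 2 hcQ) (pow_ne_zero 2 hwQ)) hcKQ),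
      padicValRat.mul (by norm_num) (pow_ne_zero 2 hIQ), padicValRat.mul (mul_ne_zero (pow_ne_zero 2 hcQ) (pow_ne_zero 2 hwQ)) hcKQ,
      padicValRat.mul (pow_ne_zero 2 hcQ) (pow_ne_zero 2 hwQ), padicValRat.pow, padicValRat.pow, padicValRat.pow, h4val, hw2, hcval,
      h2val, padicValRat.of_nat, padicValRat.of_nat]
    push_cast
    ring
  have hv : padicValRat 2 (4 * (I : ℚ) ^ 2 / ((Dt.c : ℚ) ^ 2 * (Units.torsionOrder K : ℚ) ^ 2 *
      ((W.baseChange K).tamagawaProduct : ℚ))) = padicValNat 2 (W.baseChange K).shaOrder := by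
    rw [hLHS, htam]
    have hidx' : (2 * padicValNat 2 I : ℤ) =
        (padicValNat 2 (W.baseChange K).shaOrder : ℤ) + 2 * (padicValNat 2 W.tamagawaProduct : ℤ) +
          2 * (padicValNat 2 Dt.c.natAbs : ℤ) := by
      exact_mod_cast hidx
    push_cast
    linarith
  ------------------------------------------------------------------ cell bsd-p2's over-`K` descent (Milne) and the twist hypothesis
  haveI : (W.baseChange K).IsGloballyMinimal := W.isGloballyMinimal_baseChange_of_satisfiesHeegnerHypothesis K h2 (hN ▸ hHN)
  have hD0 : (NumberField.discr K : ℚ) ≠ 0 := by exact_mod_cast NumberField.discr_ne_zero K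
  haveI hEt : (W.quadraticTwist (NumberField.discr K : ℚ)).IsElliptic := W.isElliptic_quadraticTwist hD0
  have hrK : (W.baseChange K).analyticRank = 1 :=
    (Summit.BirchSwinnertonDyer.Rank1Residual.P2.analyticRank_baseChange_eq_one_iff W K hmod h2).mpr
      (Or.inl ⟨hr, ((W.quadraticTwist (NumberField.discr K : ℚ)).analyticRank_eq_zero_iff_holds (hmod _)).mpr hLt⟩)
  obtain ⟨Cd, hCd⟩ := hasGlobalMinimalModel_rat_holds (W.quadraticTwist (NumberField.discr K : ℚ))
  haveI : (Cd • W.quadraticTwist (NumberField.discr K : ℚ)).IsGloballyMinimal := hCd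
  have hWd : BSDp (Cd • W.quadraticTwist (NumberField.discr K : ℚ)) 2 := hTw (Cd • W.quadraticTwist (NumberField.discr K : ℚ)) ⟨Cd, rfl⟩
  exact (Summit.BirchSwinnertonDyer.Rank1Residual.P2.bsdp_iff_bsdp_twist_of_heegnerIndexOverK W 2 K
    (Cd • W.quadraticTwist (NumberField.discr K : ℚ)) N Dt H ιK P (hGZ _ W K) hKoK hGZK hmod hMilne hK hHN hP hc0 hrK ⟨Cd, rfl⟩ hv).mpr hWd

end Summit.BirchSwinnertonDyer.BirchSwinnertonDyer.Theorems.PrintCf2.EisensteinTwo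

end
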